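import Literature.MathematicalPhysics.QuantumFieldTheory.Balaban1983to89.B13GreenCentreDecayOfCoercive
import Literature.MathematicalPhysics.QuantumFieldTheory.Balaban1983to89.B13GreenStationLocated
import Literature.MathematicalPhysics.QuantumFieldTheory.Balaban1983to89.B13OpsYPencilRProjSymLocated

/-!
# `Balaban1983to89.B13GreenStationCoerciveLocated` — T. Bałaban, *Propagators for lattice gauge theories in a background field*, Commun. Math. Phys. **99** (1985) 389–434
# [Balaban1985BackgroundPropagators], (3.10) p. 392, (3.26)–(3.27) p. 395, Thm 3.3 p. 399, Thm 3.4 and (3.50) p. 400, (3.84)–(3.86) p. 407, Thm 3.10 (3.107)–(3.108)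
# pp. 415–416, Thm 3.11 p. 416; *Propagators and renormalization transformations … II*, Commun. Math. Phys. **96** (1984) 223–250 [Balaban1984PropagatorsII] (2.19) and
# p. 226, Lemma 2.1 (2.61) p. 234; [Balaban1988RG2Cluster] (2.5)–(2.7) pp. 12–13, p. 15: ★★★ dag-n10-w2's QUANTITATIVE G-STATION (`B13GreenCentreDecayOfCoercive` §5
# `rawEntryLetters_toMatrix_GAY_parBY_prodCfg_of_pencil_of_coercive` — the last inverse's N06 input = ONE FORM BOUND `hco` with constant `m`) LOCATED — every NODE-00 numeral
# a number at `(M_N(ℂ), matrix units, fineReadingY ∕ bondReadingY, G ≤ U(N))`; the QUANTITATIVE twin of this seat's `B13GreenStationLocated`.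

THE DISPLAY.  dag-n10-w2 g3's §5 theorem reads `G(e^{iηA′}U₀) = Δ_a(e^{iηA′}U₀)⁻¹` along pv27's pencil with EXPLICIT radius ∕ rate ∕ constant `(R∕(4B′Θ(4∕m)M² + 1), ρ′,
2Θ(4∕m))` from the R-station's output `hR`, the ONE form bound `hco : m·trIP w Ψ Ψ ≤ trIP w Ψ (Δ_a(U₀)Ψ)` (Theorem 3.11 ∕ [4] p. 226 quantitatively — N06's; the lane's
LOCATED-ASK for it stands), a dominating constant `B′` for the assembled `Δ_a` letters (stated once, `hBΔ`), the Combes–Thomas window `0 ≤ κ ≤ ρ∕4`, `8(ΘB′)κM ≤ mρ`, a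
target `0 ≤ ρ′ < κ`, AND the NODE-00 numerals of 76 §4 and of the G-station (`K₀ c₁ c₂ N_b D c_Q c_{Q*} c_a s C_∂ C_∂* r′ m_F`).  THIS FILE writes the numerals in —
exactly as `B13DeltaAPencilLettersLocated` ∕ `B13GreenStationLocated` did for the qualitative road: `K₀ = 1` (79, `G ≤ U(N)`), `c₁ = 4|c_f|`, `c₂ = 4(d+1)|c_f|`, `N_b = 4(d+1)`
(dag-n10-w6), `D = (d+2)(L^k − 1)`, `c_Q = 1`, `c_{Q*} = 2`, `c_a = |b₁|c_f²(L^k)^{d+1}`, `s = 2(d+2)(L^k − 1)` (this seat), `C_∂ = C_∂* = 2|c_f|` (`B13GreenStationLocated` §1),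
`r′ = 1`, `m_F = (d+1)·N²` (`B13BlockBondReadingNumerals`), `ℓS := fineReadingY`, `ℓF := bondReadingY`.  What stays displayed: `hG`, `hU₀`, `hNf`, `η`, `0 < Rd`, `0 < ρ`,
`hR` (the R-station's output at the fine reading — dag-n10-w2 g4's `B13OpsYPencilRProjSymLocated` supplies it on (3.35)), `B′` with the located inequality `hBΔ` (its
left side now a NUMBER in `(d, L, k, N, c_f, b₁, η, Rd, ρ, B_R)`), the form bound `(w, Θ, m, hco)`, the window `(κ, hκ4, hκm)` and the target `ρ′`.

[folklore] positional applications of cited tree theorems (§1 one application; §2 one `obtain` + one application); kernel-checked; THEOREMS ONLY (no `def`, no `structure`, no instance, no notation;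
`open scoped Matrix.Norms.L2Operator` = the record's norm); NOTHING of NODE 00's ∕ pv27's ∕ dag-n10-w2's ∕ dag-n10-w5's ∕ dag-n10-w6's files is modified; nothing here is a claim about
the Yang–Mills mass gap; no node is discharged; count-neutral.

WHY THIS FILE (cell `pub-ymgap`, HUMAN RULING D-0062 ∕ D-0149, Track A node N10 = [B13]; WIDTH SEAT `pub-ymgap-dag-n10-w4` g5, CLAIM-7 (R455 (A)); lane owner
dag-n10-c's RESIDUAL CENSUS v19 «What would move N10 next» item 1: «the quantitative `hco` … makes the constants located» — this is the N10-side statement that does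
so, ready for N06's `hco` BY NAME).  WHICH reading ∕ coordinates the N10 term of record uses is NODE 00's ∕ def-T's word — NOT claimed here; a LOCATED INSTANCE.

WHAT THIS FILE PROVES (all `theorem`s).
* §1 ★★★ `rawEntryLetters_toMatrix_GAY_parBY_prodCfg_of_pencil_of_coercive_located` — dag-n10-w2's §5 with every NODE-00 ∕ reading ∕ basis numeral a number; conclusion
  `RawEntryLetters (A′ ↦ toMatrix (G(e^{iηA′}U₀))) (bondReadingY ∘ fst) (Rd∕(4·B′·Θ(4∕m)·((d+1)N²·c₀(1,(κ−ρ′)∕3)^{d+1})² + 1)) ρ′ (2Θ(4∕m))`.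
* §2 ★★★★ `exists_rawEntryLetters_toMatrix_GAY_recordV4_prodCfg_of_reg335_of_coercive_located` — THE END-TO-END QUANTITATIVE located chain on the (3.35) class at the v4
  letters of record (offered to this seat by dag-n10-w2 g4, bus l.≈36760): §1 with `hR` DISCHARGED by dag-n10-w2 g4's located R-station fed by dag-n10-w5's located X⁻¹
  (`B13OpsYPencilRProjSymLocated.rawEntryLetters_toMatrix_RY_parSymY_prodCfg_of_reg335_located_of_xinvLocated`), the dominating constant displayed ONCE as
  `hBΔ : ∀ R, 0 < R → R ≤ Rc → N(R) ≤ B′` (`N(R)` a number; used at the ∃-radius `R₁ ≤ R₁⋆ ≤ Rc`) — displayed: the (3.35) data, `η`, `Rc`, the G′ rate window, w5's X⁻¹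
  window, the R-loss `μ`, `B′`, the form bound `(w, Θ, m, hco)`, the Combes–Thomas window and the target rate; NO dictionary numeral, NO G′ ∕ X⁻¹ ∕ R letter.
HONEST FRAMING: located instance; finite-lattice constants, NOT optimised, NOT print's `O(1)`; the analytic inputs `hR` (Theorems 3.1 ∕ 3.2 through the R-station) and
`hco` (Theorems 3.3 ∕ 3.11 for `Δ_a`, bond sector, quantitatively — NOT in the tree on (3.35)) are DISPLAYED, not proved; nothing of Bałaban's asserted; N06 ∕ N10 NOT
discharged; K1⁹ stmt-QuantumFields-27364 OPEN, no registered stub proved; counts unmoved (typed 28∕28 · discharged 5∕27); 0 `def`, 0 `sorry`, standard axioms; one finite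
𝕋⁴ programme at fixed ε, Bałaban AS PRINTED — R4 closes the conditional finite-𝕋⁴ rung `BalabanLadder.UV` only; the YM mass gap (Clay) is NOT proved by any of this; nothing
continuum ∕ ℝ⁴ ∕ OS.

References: T. Bałaban, CMP 99 (1985) 389–434 [Balaban1985BackgroundPropagators] (3.10) p.392, (3.26)–(3.27) p.395, Thm 3.3 p.399, Thm 3.4 and (3.50) p.400, (3.84)–(3.86)
p.407, Thm 3.10 (3.107)–(3.108) pp.415–416, Thm 3.11 p.416; CMP 96 (1984) 223–250 [Balaban1984PropagatorsII] (2.19) and p.226, Lemma 2.1 (2.61) p.234; CMP 116 (1988) 1–22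
[Balaban1988RG2Cluster] (2.5)–(2.7) pp.12–13, p.15; M. Aizenman, S. Warzel, *Random Operators* (AMS 2015) §10.3 [AizenmanWarzel2015].
-/

noncomputable section

namespace Literature.MathematicalPhysics.QuantumFieldTheory.Balaban1983to89.B13GreenStationCoerciveLocated

open Finset Module
open scoped Matrix Matrix.Norms.L2Operator
open Literature.MathematicalPhysics.QuantumFieldTheory.Balaban1983to89
open Literature.MathematicalPhysics.QuantumFieldTheory.Balaban1983to89.B9Thm37GlueTorus (tdist1)
open Literature.MathematicalPhysics.QuantumFieldTheory.Balaban1983to89.B5TorusCover (UT)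
open Literature.MathematicalPhysics.QuantumFieldTheory.Balaban1983to89.B9Thm311ReadingCoords (trIP)
open Literature.MathematicalPhysics.QuantumFieldTheory.Balaban1983to89.B13EntrywiseWalks (RawEntryLetters)
open Literature.MathematicalPhysics.QuantumFieldTheory.Balaban1983to89.B9Eq39Adjoint (prodCfg)
open Literature.MathematicalPhysics.QuantumFieldTheory.Balaban1983to89.B6GlobalChartV1 (PV)
open Literature.MathematicalPhysics.QuantumFieldTheory.Balaban1983to89.B6KLevelCensusIndexV1 (KIdx)
open Literature.MathematicalPhysics.QuantumFieldTheory.Balaban1983to89.Node00 (SiteY FBondY CfgY SiteParY SiteOpY RY deltaAY GAY parBY parSymY GpY toKT)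
open Literature.MathematicalPhysics.QuantumFieldTheory.Balaban1983to89.B6KLevelCensusIndexV1 (kGeo)
open Literature.MathematicalPhysics.QuantumFieldTheory.Balaban1983to89.B9BackgroundsKLevelV1 (bg9K)
open Literature.MathematicalPhysics.QuantumFieldTheory.Balaban1983to89.B13GreenCentreDecayOfCoercive (rawEntryLetters_toMatrix_GAY_parBY_prodCfg_of_pencil_of_coercive)
open Literature.MathematicalPhysics.QuantumFieldTheory.Balaban1983to89.B13SiteReadingNumerals (fineReadingY)
open Literature.MathematicalPhysics.QuantumFieldTheory.Balaban1983to89.B13BlockBondReadingNumerals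
  (bondReadingY hℓG_bondReadingY hℓD_bondReadingY card_fibre_bondReadingY_matrixUnits)
open Literature.MathematicalPhysics.QuantumFieldTheory.Balaban1983to89.B13BondAveragingReadingNumerals (hD_qK hD'_qsK hℓq_bondReadingY)
open Literature.MathematicalPhysics.QuantumFieldTheory.Balaban1983to89.B13CurlIncidenceNumerals (sum_abs_curlK_le card_filter_edgeY_le sum_abs_cocurlK_le)
open Literature.MathematicalPhysics.QuantumFieldTheory.Balaban1983to89.B13DeltaAPencilLettersLocated
  (hcQ_le_one hcQs_le_two hca_of_globalBand ca_globalBand_nonneg hℓp_bondReadingY_rangeQ2)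
open Literature.MathematicalPhysics.QuantumFieldTheory.Balaban1983to89.B13GreenStationLocated (sum_abs_gradK_le sum_abs_divK_le)
open Literature.MathematicalPhysics.QuantumFieldTheory.Balaban1983to89.B13GreenPrimeSymLettersOfReg335 (norm_unit_le_one_of_mem)

variable {d ℓ : ℕ} {hd : 1 ≤ d + 1} {hL : Odd (ℓ + 1) ∧ 1 < ℓ + 1} {b₀ b₁ : ℝ}
variable (i : KIdx d ℓ hd hL b₀ b₁) {N : ℕ} [NeZero N] {G : Subgroup (Matrix (Fin N) (Fin N) ℂ)ˣ}
variable {Nf : Fin (d + 1) → ℕ} [∀ μ, NeZero (Nf μ)]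

/-- ★★★ **dag-n10-w2's QUANTITATIVE G-STATION LOCATED — `G(e^{iηA′}U₀)` with explicit radius ∕ rate ∕ constant from `hR` + ONE form bound `hco`, every NODE-00 numeral a
number.**  For a `G`-valued background `U₀` (`G ≤ U(N)`), matrix-unit coordinates, sites read by `fineReadingY`, bonds by `bondReadingY`: `B13GreenCentreDecayOfCoercive`'s
`rawEntryLetters_toMatrix_GAY_parBY_prodCfg_of_pencil_of_coercive` with `K₀ = 1`, `c₁ = 4|c_f|`, `c₂ = 4(d+1)|c_f|`, `N_b = 4(d+1)`, `D = (d+2)(L^k−1)`, `c_Q = 1`, `c_{Q*} = 2`,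
`c_a = |b₁|c_f²(L^k)^{d+1}`, `s = 2(d+2)(L^k−1)`, `C_∂ = C_∂* = 2|c_f|`, `r′ = 1`, `m_F = (d+1)N²`.  DISPLAYED ONLY: `hG`, `hU₀`, `hNf`, `η`, `0 < Rd`, `0 < ρ`, the R-station's output
`hR`, the dominating constant `B′` (`hBΔ`, left side a number), the form bound `(w, Θ, m, hco)`, the window `0 ≤ κ ≤ ρ∕4` with `8(ΘB′)κ((d+1)N²c₀(1,ρ∕2)^{d+1}) ≤ mρ`, and
`0 ≤ ρ′ < κ`.
[cite: Balaban1985BackgroundPropagators, (3.10) p.392, (3.26)–(3.27) p.395, Thm 3.3 p.399, Thm 3.4 and (3.50) p.400, (3.84)–(3.86) p.407, Thm 3.10 (3.107)–(3.108) pp.415–416, Thm 3.11 p.416; Balaban1984PropagatorsII, (2.19) and p.226, Lemma 2.1 (2.61) p.234; Balaban1988RG2Cluster, (2.5)–(2.7) pp.12–13, p.15; AizenmanWarzel2015, §10.3] -/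
theorem rawEntryLetters_toMatrix_GAY_parBY_prodCfg_of_pencil_of_coercive_located
    (parS : SiteParY (Matrix (Fin N) (Fin N) ℂ) i) (Gp : SiteOpY (Matrix (Fin N) (Fin N) ℂ) i)
    (hG : G ≤ B7Prop2Explicit.unitaryUnits (Matrix (Fin N) (Fin N) ℂ))
    {U₀ : CfgY (Matrix (Fin N) (Fin N) ℂ) i} (hU₀ : ∀ μ x, U₀ μ x ∈ G)
    (hNf : ∀ μ, (toKT i).NB μ = Nf μ) (η : ℝ) {Rd : ℝ} (hRpos : 0 < Rd)
    {ρ BR : ℝ} (hρ : 0 < ρ)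
    (hR : RawEntryLetters (fun a : Fin (d + 1) → Site (PV d ℓ i.m i.K hd hL) 0 → Matrix (Fin N) (Fin N) ℂ =>
      LinearMap.toMatrix
        ((Pi.basis fun _ : SiteY i => Matrix.stdBasis ℂ (Fin N) (Fin N)).reindex (Equiv.sigmaEquivProd (SiteY i) (Fin N × Fin N)))
        ((Pi.basis fun _ : SiteY i => Matrix.stdBasis ℂ (Fin N) (Fin N)).reindex (Equiv.sigmaEquivProd (SiteY i) (Fin N × Fin N)))
        (RY i parS Gp (prodCfg U₀ η a)))
      (fun q : SiteY i × (Fin N × Fin N) => fineReadingY i hNf q.1) Rd ρ BR)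
    {B' : ℝ}
    (hBΔ : 1 * (((4 * ((d : ℝ) + 1) * |i.cf|) * ((1 * Real.exp (|η| * Rd)) * ((1 * Real.exp (|η| * Rd)) ^ 4 * ((4 * |i.cf|) * ((1 * Real.exp (|η| * Rd)) * 1 * (1 * Real.exp (|η| * Rd))))) * (1 * Real.exp (|η| * Rd))) + 1 / 2 * ((4 * ((d : ℝ) + 1)) * ((1 * Real.exp (|η| * Rd)) * (2 * (i.cf ^ 2 * (1 * Real.exp (|η| * Rd)) ^ 4) * (8 * ((1 * Real.exp (|η| * Rd)) * 1 * (1 * Real.exp (|η| * Rd))))) * (1 * Real.exp (|η| * Rd))))) + 2 * ((1 * Real.exp (|η| * Rd)) ^ ((d + 2) * ((ℓ + 1) ^ i.k - 1)) * ((|b₁| * i.cf ^ 2 * ((((ℓ + 1 : ℕ) : ℝ)) ^ i.k) ^ (d + 1)) * (1 * ((1 * Real.exp (|η| * Rd)) ^ ((d + 2) * ((ℓ + 1) ^ i.k - 1)) * 1 * (1 * Real.exp (|η| * Rd)) ^ ((d + 2) * ((ℓ + 1) ^ i.k - 1))))) * (1 * Real.exp (|η| * Rd)) ^ ((d + 2)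 * ((ℓ + 1) ^ i.k - 1)))) * Real.exp (ρ * (2 * (((d : ℝ) + 2) * ((((ℓ + 1) ^ i.k : ℕ) : ℝ) - 1)))) +
          (2 * |i.cf|) * (Fintype.card (Fin N × Fin N) : ℝ) * (1 * ((1 * Real.exp (|η| * Rd)) * 1 * (1 * Real.exp (|η| * Rd)))) * ((2 * |i.cf|) * (Fintype.card (Fin N × Fin N) : ℝ) * (1 * ((1 * Real.exp (|η| * Rd)) * 1 * (1 * Real.exp (|η| * Rd))))) * BR * Real.exp (2 * ρ * 1) ≤ B')

    (w : FBondY i → ℝ) (hw : ∀ s, 0 < w s) {Θ : ℝ} (hΘ0 : 0 ≤ Θ) (hΘ : ∀ s t : FBondY i, Real.sqrt (w s) ≤ Θ * Real.sqrt (w t))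
    {m : ℝ} (hm : 0 < m)
    (hco : ∀ Ψ : FBondY i → Matrix (Fin N) (Fin N) ℂ, m * trIP w Ψ Ψ ≤ trIP w Ψ (deltaAY i parS (parBY i) Gp U₀ Ψ))
    {κ : ℝ} (hκ : 0 ≤ κ) (hκ4 : κ ≤ ρ / 4) (hκm : 8 * (Θ * B') * κ * ((((d + 1) * (N * N) : ℕ) : ℝ) * B6.c0 1 (ρ / 2) ^ (d + 1)) ≤ m * ρ)
    {ρ' : ℝ} (hρ'0 : 0 ≤ ρ') (hρ' : ρ' < κ) :
    RawEntryLetters (fun a : Fin (d + 1) → Site (PV d ℓ i.m i.K hd hL) 0 → Matrix (Fin N) (Fin N) ℂ =>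
        LinearMap.toMatrix
          ((Pi.basis fun _ : FBondY i => Matrix.stdBasis ℂ (Fin N) (Fin N)).reindex (Equiv.sigmaEquivProd (FBondY i) (Fin N × Fin N)))
          ((Pi.basis fun _ : FBondY i => Matrix.stdBasis ℂ (Fin N) (Fin N)).reindex (Equiv.sigmaEquivProd (FBondY i) (Fin N × Fin N)))
          (GAY i parS (parBY i) Gp (prodCfg U₀ η a)))
      (fun p : FBondY i × (Fin N × Fin N) => bondReadingY i hNf p.1)
      (Rd / (4 * (B' * (Θ * (4 / m)) * ((((d + 1) * (N * N) : ℕ) : ℝ) * B6.c0 1 ((κ - ρ') / 3) ^ (d + 1)) * ((((d + 1) * (N * N) : ℕ) : ℝ) * B6.c0 1 ((κ - ρ') / 3) ^ (d + 1))) + 1)) ρ' (2 * (Θ * (4 / m))) :=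
  rawEntryLetters_toMatrix_GAY_parBY_prodCfg_of_pencil_of_coercive i parS Gp U₀ η (norm_unit_le_one_of_mem i hG hU₀).1 (norm_unit_le_one_of_mem i hG hU₀).2
    le_rfl hRpos (by positivity) (by positivity) (sum_abs_curlK_le i) (sum_abs_cocurlK_le i) (by positivity) (card_filter_edgeY_le i) (hD_qK i) (hD'_qsK i)
    zero_le_one zero_le_two (ca_globalBand_nonneg i) (hcQ_le_one i) (hcQs_le_two i) (hca_of_globalBand i) (bondReadingY i hNf) (hℓp_bondReadingY_rangeQ2 i hNf)
    (hℓq_bondReadingY i hNf) (by positivity) (sum_abs_gradK_le i) (by positivity) (sum_abs_divK_le i) (fineReadingY i hNf) (hℓG_bondReadingY i hNf)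
    (hℓD_bondReadingY i hNf) (card_fibre_bondReadingY_matrixUnits i hNf) hρ hR hBΔ w hw hΘ0 hΘ hm hco hκ hκ4 hκm hρ'0 hρ'

/-! ## §2. ★★★★ The END-TO-END QUANTITATIVE located chain on (3.35): `hR` discharged by dag-n10-w2 g4's located R-station (itself fed by dag-n10-w5's located X⁻¹) -/

/-- ★★★★ **THE QUANTITATIVE v4 G-CHAIN ON (3.35) AT THE READINGS OF RECORD — `G′ (w6) → X⁻¹ (w5) → R (w2) → G (§1)` — N06-SIDE INPUT = ONE FORM BOUND.**  For EVERY
background `U₀ ∈ (bg9K (M_N ℂ) G i).Reg335 c α₀` (`G ≤ U(N)`, `0 ≤ c·M·α₀`, `c·M·α₀·(d+1) ≤ 1∕16`): §1 at `parS := parSymY i`, `Gp := GpY i (parSymY i)` with `hR :=`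
dag-n10-w2 g4's `B13OpsYPencilRProjSymLocated.rawEntryLetters_toMatrix_RY_parSymY_prodCfg_of_reg335_located_of_xinvLocated` (radius `R₁ ≤ R₁⋆(79 at the fine reading) ≤ Rc`,
rate `ρ″ − 2μ`, constant `B_R(R₁)` a NUMBER).  DISPLAYED ONLY: the (3.35) data, `η`, `0 < Rc`, the G′ rate `0 ≤ ρ′ < δ₀∕((d+1)L^k)`, dag-n10-w5's X⁻¹ window
`(μ_X, κ_X, hκm_X, ρ″)`, the R-station's loss `0 < μ`, `2μ < ρ″`, ONE dominating constant `B′` — stated ONCE as `hBΔ : ∀ R, 0 < R → R ≤ Rc → N(R) ≤ B′` with `N(R)` a NUMBER in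
`(d, L, k, N, c_f, b₁, η, R, ρ″, μ)` (the assembled `Δ_a` letters' constant at radius `R`; monotone in `R`, so `N(Rc) ≤ B′` suffices) —, the form bound `(w, Θ, m, hco)` for
def-Y's `Δ_a(U₀) = deltaAY i (parSymY i) (parBY i) (GpY i (parSymY i)) U₀` (Theorem 3.11 ∕ [4] p.226 quantitatively — N06's; the lane's LOCATED-ASK), the Combes–Thomas
window `0 ≤ κ ≤ (ρ″−2μ)∕4`, `8(ΘB′)κ((d+1)N²c₀(1,(ρ″−2μ)∕2)^{d+1}) ≤ m(ρ″−2μ)` and a target `0 ≤ ρ_t < κ`.  Conclusion: `∃ R₁, 0 < R₁ ∧ R₁ ≤ R₁⋆ ∧ RawEntryLetters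
(A′ ↦ toMatrix (G(e^{iηA′}U₀))) (bondReadingY ∘ fst) (R₁∕(4B′Θ(4∕m)((d+1)N²c₀(1,(κ−ρ_t)∕3)^{d+1})² + 1)) ρ_t (2Θ(4∕m))` — explicit rate and constant; NO dictionary numeral, NO
G′ ∕ X⁻¹ ∕ R letter displayed.
[cite: Balaban1985BackgroundPropagators, (3.19)–(3.27) pp.393–395, (3.35) p.396, Thm 3.1 (3.42) p.397, Thm 3.2 (3.48) p.398, Thm 3.3 p.399, Thm 3.4 p.400, (3.84)–(3.86) p.407, Thm 3.10 (3.107)–(3.108) pp.415–416, Thm 3.11 p.416; Balaban1984PropagatorsII, (2.19) and p.226, Lemma 2.1 (2.61) p.234; Balaban1988RG2Cluster, (2.5)–(2.7) pp.12–13, p.15; AizenmanWarzel2015, §10.3] -/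
theorem exists_rawEntryLetters_toMatrix_GAY_recordV4_prodCfg_of_reg335_of_coercive_located
    (hG : G ≤ B7Prop2Explicit.unitaryUnits (Matrix (Fin N) (Fin N) ℂ))
    {U₀ : CfgY (Matrix (Fin N) (Fin N) ℂ) i} {c α₀ : ℝ} (hC0 : 0 ≤ c * (kGeo i).M * α₀) (hC1 : c * (kGeo i).M * α₀ * ((d : ℝ) + 1) ≤ 1 / 16)
    (hreg : (bg9K (Matrix (Fin N) (Fin N) ℂ) G i).Reg335 c α₀ U₀)
    (η : ℝ) {Rc : ℝ} (hRc : 0 < Rc) {ρ' : ℝ} (hρ'0 : 0 ≤ ρ')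
    (hρ' : ρ' < (1 / (4 * ((d : ℝ) + 2))) * ((((d : ℝ) + 1) * ((((ℓ + 1) ^ i.k : ℕ) : ℝ)))⁻¹))
    {μX : ℝ} (hμX : 0 < μX) (hμρ : μX < ρ')
    {κX : ℝ} (hκX : 0 ≤ κX) (hκ4X : κX ≤ (ρ' - μX) / 4)
    (hκmX : 8 * (Real.sqrt ((((ℓ : ℝ) + 1) ^ i.k) ^ (d + 1)) *
        (1 * (Fintype.card (Fin N × Fin N) : ℝ) *
            (1 * ((1 * Real.exp (|η| * Rc)) ^ ((d + 1) * ((ℓ + 1) ^ i.k - 1)) * 1 * (1 * Real.exp (|η| * Rc)) ^ ((d + 1) * ((ℓ + 1) ^ i.k - 1)))) *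
          ((((ℓ : ℝ) + 1) ^ i.k) ^ (d + 1) * (Fintype.card (Fin N × Fin N) : ℝ) *
            (1 * ((1 * Real.exp (|η| * Rc)) ^ ((d + 1) * ((ℓ + 1) ^ i.k - 1)) * 1 * (1 * Real.exp (|η| * Rc)) ^ ((d + 1) * ((ℓ + 1) ^ i.k - 1))))) *
          ((2 * (1 * 1 * (16 * ((((ℓ + 1) ^ i.k : ℕ) : ℝ)) ^ 2 * Real.sqrt N))) * (2 * (1 * 1 * (16 * ((((ℓ + 1) ^ i.k : ℕ) : ℝ)) ^ 2 * Real.sqrt N))) *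
            (((N * N : ℕ) : ℝ) * B6.c0 1 μX ^ (d + 1))) *
          Real.exp (2 * (ρ' - μX) * (((d : ℝ) + 1) * (((((ℓ + 1) ^ i.k : ℕ) : ℝ)) - 1))))) * κX *
        (((N * N : ℕ) : ℝ) * B6.c0 1 ((ρ' - μX) / 2) ^ (d + 1)) ≤
      ((4 * ((d : ℝ) + 1) + 1) ^ 2)⁻¹ * (ρ' - μX))
    {ρ'' : ℝ} (hρ''0 : 0 ≤ ρ'') (hρ'' : ρ'' < κX)
    {μ : ℝ} (hμ : 0 < μ) (h2μ : 2 * μ < ρ'')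
    {B' : ℝ}
    (hBΔ : ∀ R : ℝ, 0 < R → R ≤ Rc →
      1 * (((4 * ((d : ℝ) + 1) * |i.cf|) * ((1 * Real.exp (|η| * R)) * ((1 * Real.exp (|η| * R)) ^ 4 * ((4 * |i.cf|) * ((1 * Real.exp (|η| * R)) * 1 * (1 * Real.exp (|η| * R))))) * (1 * Real.exp (|η| * R))) + 1 / 2 * ((4 * ((d : ℝ) + 1)) * ((1 * Real.exp (|η| * R)) * (2 * (i.cf ^ 2 * (1 * Real.exp (|η| * R)) ^ 4) * (8 * ((1 * Real.exp (|η| * R)) * 1 * (1 * Real.exp (|η| * R))))) * (1 * Real.exp (|η| * R))))) + 2 * ((1 * Real.exp (|η| * R)) ^ ((d + 2) * ((ℓ + 1) ^ i.k - 1)) * ((|b₁| * i.cf ^ 2 * ((((ℓ + 1 : ℕ) : ℝ)) ^ i.k) ^ (d + 1)) * (1 * ((1 * Real.exp (|η| * R)) ^ ((d + 2) * ((ℓ + 1) ^ i.k - 1)) * 1 * (1 * Real.exp (|η| * R)) ^ ((d + 2) * ((ℓ + 1) ^ i.k - 1))))) * (1 * Real.exp (|η| * R)) ^ ((d + 2)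 * ((ℓ + 1) ^ i.k - 1)))) * Real.exp ((ρ'' - 2 * μ) * (2 * (((d : ℝ) + 2) * ((((ℓ + 1) ^ i.k : ℕ) : ℝ) - 1)))) +
          (2 * |i.cf|) * (Fintype.card (Fin N × Fin N) : ℝ) * (1 * ((1 * Real.exp (|η| * R)) * 1 * (1 * Real.exp (|η| * R)))) * ((2 * |i.cf|) * (Fintype.card (Fin N × Fin N) : ℝ) * (1 * ((1 * Real.exp (|η| * R)) * 1 * (1 * Real.exp (|η| * R))))) * (1 + 2 * (1 * 1 * (16 * ((((ℓ + 1) ^ i.k : ℕ) : ℝ)) ^ 2 * Real.sqrt N)) *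
            (1 * (Fintype.card (Fin N × Fin N) : ℝ) *
                (1 * ((1 * Real.exp (|η| * R)) ^ ((d + 1) * ((ℓ + 1) ^ i.k - 1)) * 1 * (1 * Real.exp (|η| * R)) ^ ((d + 1) * ((ℓ + 1) ^ i.k - 1)))) *
              (1 * (Fintype.card (Fin N × Fin N) : ℝ) *
                (1 * ((1 * Real.exp (|η| * R)) ^ ((d + 1) * ((ℓ + 1) ^ i.k - 1)) * 1 * (1 * Real.exp (|η| * R)) ^ ((d + 1) * ((ℓ + 1) ^ i.k - 1))))) *
              (2 * (1 * 1 * ((N : ℝ) ^ 3 * (Real.sqrt ((((ℓ : ℝ) + 1) ^ i.k) ^ (d + 1)) * (4 / ((4 * ((d : ℝ) + 1) + 1) ^ 2)⁻¹))))) *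
              Real.exp (2 * ρ'' * (((d : ℝ) + 1) * ((((ℓ + 1) ^ i.k : ℕ) : ℝ) - 1))) * (2 * (1 * 1 * (16 * ((((ℓ + 1) ^ i.k : ℕ) : ℝ)) ^ 2 * Real.sqrt N))) *
              (((N * N : ℕ) : ℝ) * B6.c0 1 μ ^ (d + 1))) *
            (((N * N : ℕ) : ℝ) * B6.c0 1 μ ^ (d + 1))) * Real.exp (2 * (ρ'' - 2 * μ) * 1) ≤ B')
    (w : FBondY i → ℝ) (hw : ∀ s, 0 < w s) {Θ : ℝ} (hΘ0 : 0 ≤ Θ) (hΘ : ∀ s t : FBondY i, Real.sqrt (w s) ≤ Θ * Real.sqrt (w t))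
    {m : ℝ} (hm : 0 < m)
    (hco : ∀ Ψ : FBondY i → Matrix (Fin N) (Fin N) ℂ, m * trIP w Ψ Ψ ≤ trIP w Ψ (deltaAY i (parSymY i) (parBY i) (GpY i (parSymY i)) U₀ Ψ))
    {κ : ℝ} (hκ : 0 ≤ κ) (hκ4 : κ ≤ (ρ'' - 2 * μ) / 4)
    (hκm : 8 * (Θ * B') * κ * ((((d + 1) * (N * N) : ℕ) : ℝ) * B6.c0 1 ((ρ'' - 2 * μ) / 2) ^ (d + 1)) ≤ m * (ρ'' - 2 * μ))
    {ρt : ℝ} (hρt0 : 0 ≤ ρt) (hρt : ρt < κ) :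
    ∃ R₁ : ℝ, 0 < R₁ ∧ R₁ ≤ Rc / (4 * ((1 * (((d : ℝ) + 1) *
          (1 * Real.exp (|η| * Rc) * (1 * Real.exp (|η| * Rc) * 1 * (1 * Real.exp (|η| * Rc)) + 1) * (1 * Real.exp (|η| * Rc)) +
            (1 * Real.exp (|η| * Rc) * 1 * (1 * Real.exp (|η| * Rc)) + 1)) +
          1 * ((1 * Real.exp (|η| * Rc)) ^ (2 * (d + 1) * ((ℓ + 1) ^ i.k - 1)) * 1 * (1 * Real.exp (|η| * Rc)) ^ (2 * (d + 1) * ((ℓ + 1) ^ i.k - 1)))) *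
            Real.exp ((1 / (4 * ((d : ℝ) + 2)) * ((((d : ℝ) + 1) * ((((ℓ + 1) ^ i.k : ℕ) : ℝ)))⁻¹)) * (((d : ℝ) + 1) * ((((ℓ + 1) ^ i.k : ℕ) : ℝ))))) *
          (1 * 1 * (16 * ((((ℓ + 1) ^ i.k : ℕ) : ℝ)) ^ 2 * Real.sqrt N)) *
          (((N * N : ℕ) : ℝ) * B6.c0 1 (((1 / (4 * ((d : ℝ) + 2))) * ((((d : ℝ) + 1) * ((((ℓ + 1) ^ i.k : ℕ) : ℝ)))⁻¹) - ρ') / 3) ^ (d + 1)) *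
          (((N * N : ℕ) : ℝ) * B6.c0 1 (((1 / (4 * ((d : ℝ) + 2))) * ((((d : ℝ) + 1) * ((((ℓ + 1) ^ i.k : ℕ) : ℝ)))⁻¹) - ρ') / 3) ^ (d + 1))) + 1) ∧
  RawEntryLetters (fun a : Fin (d + 1) → Site (PV d ℓ i.m i.K hd hL) 0 → Matrix (Fin N) (Fin N) ℂ =>
        LinearMap.toMatrix
          ((Pi.basis fun _ : FBondY i => Matrix.stdBasis ℂ (Fin N) (Fin N)).reindex (Equiv.sigmaEquivProd (FBondY i) (Fin N × Fin N)))
          ((Pi.basis fun _ : FBondY i => Matrix.stdBasis ℂ (Fin N) (Fin N)).reindex (Equiv.sigmaEquivProd (FBondY i) (Fin N × Fin N)))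
          (GAY i (parSymY i) (parBY i) (GpY i (parSymY i)) (prodCfg U₀ η a)))
      (fun p : FBondY i × (Fin N × Fin N) => bondReadingY i i.hN p.1)
      (R₁ / (4 * (B' * (Θ * (4 / m)) * ((((d + 1) * (N * N) : ℕ) : ℝ) * B6.c0 1 ((κ - ρt) / 3) ^ (d + 1)) * ((((d + 1) * (N * N) : ℕ) : ℝ) * B6.c0 1 ((κ - ρt) / 3) ^ (d + 1))) + 1)) ρt (2 * (Θ * (4 / m))) := by
  -- R along the pencil on (3.35) at the fine reading, `hXi` discharged (dag-n10-w2 g4 ∘ dag-n10-w5), at some radius `0 < R₁ ≤ R₁⋆`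
  obtain ⟨R₁, hR₁, hR₁le, hR⟩ :=
    B13OpsYPencilRProjSymLocated.rawEntryLetters_toMatrix_RY_parSymY_prodCfg_of_reg335_located_of_xinvLocated i hG hC0 hC1 hreg η hRc hρ'0 hρ' hμX hμρ hκX
      hκ4X hκmX hρ''0 hρ'' hμ h2μ.le
  -- `R₁⋆ ≤ Rc`: the thin radius divides `Rc` by `4T + 1 ≥ 1`
  have hT : 0 ≤ ((1 * (((d : ℝ) + 1) *
          (1 * Real.exp (|η| * Rc) * (1 * Real.exp (|η| * Rc) * 1 * (1 * Real.exp (|η| * Rc)) + 1) * (1 * Real.exp (|η| * Rc)) +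
            (1 * Real.exp (|η| * Rc) * 1 * (1 * Real.exp (|η| * Rc)) + 1)) +
          1 * ((1 * Real.exp (|η| * Rc)) ^ (2 * (d + 1) * ((ℓ + 1) ^ i.k - 1)) * 1 * (1 * Real.exp (|η| * Rc)) ^ (2 * (d + 1) * ((ℓ + 1) ^ i.k - 1)))) *
            Real.exp ((1 / (4 * ((d : ℝ) + 2)) * ((((d : ℝ) + 1) * ((((ℓ + 1) ^ i.k : ℕ) : ℝ)))⁻¹)) * (((d : ℝ) + 1) * ((((ℓ + 1) ^ i.k : ℕ) : ℝ))))) *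
          (1 * 1 * (16 * ((((ℓ + 1) ^ i.k : ℕ) : ℝ)) ^ 2 * Real.sqrt N)) *
          (((N * N : ℕ) : ℝ) * B6.c0 1 (((1 / (4 * ((d : ℝ) + 2))) * ((((d : ℝ) + 1) * ((((ℓ + 1) ^ i.k : ℕ) : ℝ)))⁻¹) - ρ') / 3) ^ (d + 1)) *
          (((N * N : ℕ) : ℝ) * B6.c0 1 (((1 / (4 * ((d : ℝ) + 2))) * ((((d : ℝ) + 1) * ((((ℓ + 1) ^ i.k : ℕ) : ℝ)))⁻¹) - ρ') / 3) ^ (d + 1))) :=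
    mul_nonneg (mul_nonneg (mul_nonneg
      (mul_nonneg (mul_nonneg zero_le_one (add_nonneg (by positivity) (mul_nonneg zero_le_one (by positivity)))) (Real.exp_pos _).le)
      (by positivity)) (mul_nonneg (Nat.cast_nonneg _) (pow_nonneg (B6RandomWalk.c0_nonneg 1 _) _)))
      (mul_nonneg (Nat.cast_nonneg _) (pow_nonneg (B6RandomWalk.c0_nonneg 1 _) _))
  have hR₁Rc : R₁ ≤ Rc := hR₁le.trans (div_le_self hRc.le (by linarith))
  have hρR : 0 < ρ'' - 2 * μ := by linarith
  exact ⟨R₁, hR₁, hR₁le, rawEntryLetters_toMatrix_GAY_parBY_prodCfg_of_pencil_of_coercive_located i (parSymY i) (GpY i (parSymY i)) hG hreg.1 i.hN η hR₁ hρR hR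
    (hBΔ R₁ hR₁ hR₁Rc) w hw hΘ0 hΘ hm hco hκ hκ4 hκm hρt0 hρt⟩

end Literature.MathematicalPhysics.QuantumFieldTheory.Balaban1983to89.B13GreenStationCoerciveLocated

end
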